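import Summits.PneNP.PneNP.Theorems.SymmetryBudgetWindowCanoniserSymmetryFormers

/-!
# Window canoniser, X: the DAG is symmetric under the budget

Route `PneNP/SymmetryBudget`, dichotomy `WindowBarrier` (stmt-PneNP-2145) / `NoHiddenOrder` (stmt-PneNP-14781);
continuation of `…WindowCanoniserSymmetryFormers.lean`.  For EVERY window permutation `π`, the relabelling
`WCan.Node.act π` over the input map `(a, b) ↦ (extPerm π a, extPerm π b)` is an automorphism of `WCan.wDAG out`
whenever the output wire is fixed (`WCan.isAut`): gate functions are invariant, and the argument tuple of the
relabelled gate is the relabelled argument tuple up to a permutation of positions (families indexed by vertices,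
pairs, triples, candidates or vertex subsets are re-indexed by `π`; everything else position by position).  Since
the budget consists exactly of the `extPerm π` (`…DagDefs.lean`), the compiled circuits are
`pointStabiliserBudget (r+n) n`-symmetric (`WCan.compile_isSymmetricUnder`).  Permutation bookkeeping from the
tree's `SymCR` (`perm_of_comp_eq`, `blockPerm`).
-/

-- `Summit.PneNP.PneNP.…` duplicates `PneNP` BY DESIGN (single-problem summit, D-0017 layout).
set_option linter.dupNamespace false

noncomputable section

namespace Summit.PneNP.PneNP.Theorems

namespace WCan

open Finset Equiv Literature.Computability.Complexity Literature.Computability.Complexity.SymCR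

variable {K r n : ℕ} (π : Perm (Fin n))

/-! ### Argument tuples of relabelled atoms -/

section ArgsPerm

variable [NeZero n] (L : Lab K n)

attribute [local simp] RawLab.apply_mem_act_U RawLab.apply_mem_act_X RawLab.act_lam_apply RawLab.mem_act_U
  RawLab.mem_act_X

/-- Shared atoms. -/
theorem SKind.args_perm (k : SKind) (P : Prm r n) :
    (List.ofFn (SKind.args (K := K) k (P.act π))).Perm ((List.ofFn (SKind.args (K := K) k P)).map (F π)) := by
  cases k with
  | exV => exact perm_of_eq (n := 2) fun a => by simp only [SKind.args, Prm.act_vs]; split_ifs <;> simp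
  | exO =>
    rcases ho : P.o1 with _ | o
    · exact perm_of_eq (n := 2) fun a => by simp [SKind.args, ho]
    · exact perm_of_eq (n := 2) fun a => by simp only [SKind.args, Prm.act_o1, ho, Prm.act_vs]; split_ifs <;> simp
  | rLT =>
    simp only [SKind.args, Prm.act_rd, Prm.act_vs]
    rcases hrd : P.rd with ⟨_ | t, ht⟩
    · exact perm_of_eq (n := 1) fun a => by simp
    · exact perm_of_eq (n := 1) fun a => by simp
  | rcge =>
    refine perm_of_comp_eq (n := n + n) (blockPerm π π) fun a => ?_
    simp only [SKind.args, Prm.act_vs, Prm.act_rd]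
    exact F_append π π π (fun w' => by simp) (fun w' => by simp) a
  | rallb => exact perm_of_comp_eq (n := n) π fun a => by simp [SKind.args]
  | rlex => exact perm_of_comp_eq (n := n) π fun a => by simp [SKind.args]

set_option maxHeartbeats 4000000 in
/-- Replay atoms. -/
theorem Kind.argsR_perm (k : Kind) (P : Prm r n) :
    (List.ofFn (Kind.argsR (K := K) (r := r) (L.act π) k (P.act π))).Perm ((List.ofFn (Kind.argsR L k P)).map (F π)) := by
  cases k
  case sW =>
    simp only [Kind.argsR, Prm.act_it, Prm.act_vs]
    rcases hit : P.it with ⟨_ | i, hi⟩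
    · exact perm_of_eq (n := 1) fun a => by simp
    · exact perm_of_eq (n := 1) fun a => by simp
  case sLT =>
    simp only [Kind.argsR, Prm.act_it, Prm.act_vs]
    rcases hit : P.it with ⟨_ | i, hi⟩
    · exact perm_of_eq (n := 1) fun a => by simp
    · exact perm_of_eq (n := 1) fun a => by simp
  case sC =>
    simp only [Kind.argsR, Prm.act_it, Prm.act_vs]
    rcases hit : P.it with ⟨_ | i, hi⟩
    · exact perm_of_eq (n := 1) fun a => by simp
    · exact perm_of_eq (n := 1) fun a => by simp
  case sARR =>
    simp only [Kind.argsR, Prm.act_it, Prm.act_vs]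
    rcases hit : P.it with ⟨_ | i, hi⟩
    · exact perm_of_eq (n := 1) fun a => by simp
    · exact perm_of_eq (n := 1) fun a => by simp
  case sDEAD =>
    simp only [Kind.argsR, Prm.act_it, Prm.act_vs]
    rcases hit : P.it with ⟨_ | i, hi⟩
    · exact perm_of_eq (n := 1) fun a => by simp
    · exact perm_of_eq (n := 1) fun a => by
        by_cases hU : L.1.U = ∅ <;> simp [hU]
  case frz => exact perm_of_eq (n := 3) fun a => by simp only [Kind.argsR, Prm.act_it, Prm.act_vs]; split_ifs <;> simp
  case now =>
    refine perm_of_comp_eq (n := n + n) (blockPerm π π) fun a => ?_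
    simp only [Kind.argsR, Prm.act_it]
    refine F_append π π π (fun v => ?_) (fun v => ?_) a
    · by_cases hv : v ∈ L.1.U <;> simp [hv]
    · by_cases hv : v ∈ L.1.X <;> simp [hv]
  case cnt1 =>
    refine perm_of_comp_eq (n := n + n) (blockPerm π 1) fun a => ?_
    simp only [Kind.argsR, Prm.act_it]
    exact F_cnt π π (fun v => by simp) a
  case sw =>
    refine perm_of_comp_eq (n := n * n + n * n + n * n + (n * n + n * n + n * n))
      (blockPerm (blockPerm (blockPerm (pp π π) (pp π π)) (pp π π)) 1) fun a => ?_
    simp only [Kind.argsR, Prm.act_it, Prm.act_vs]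
    refine F_cnt π _ (fun k => ?_) a
    refine F_append π _ _ (F_append π _ _ (fun i => ?_) (fun i => ?_)) (fun i => ?_) k <;> simp
  case reach =>
    simp only [Kind.argsR, Prm.act_it, Prm.act_vs, Prm.act_rd]
    rcases hrd : P.rd with ⟨_ | sv, hs⟩
    · exact perm_of_eq (n := n) fun a => by simp [F_reach0W]
    · exact perm_of_comp_eq (n := n) π fun a => by simp
  case conn => exact perm_of_comp_eq (n := n * n) (pp π π) fun a => by simp [Kind.argsR]
  case szGE =>
    refine perm_of_comp_eq (n := n + n) (blockPerm π π) fun a => ?_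
    simp only [Kind.argsR, Prm.act_it, Prm.act_vs]
    exact F_append π π π (fun y => by simp) (fun y => by simp) a
  case big =>
    refine perm_of_comp_eq (n := n + n) (blockPerm π 1) fun a => ?_
    simp only [Kind.argsR, Prm.act_it, Prm.act_vs]
    exact F_cnt π π (fun y => by simp) a
  case bmc =>
    refine perm_of_comp_eq (n := n + 2) (blockPerm π 1) fun a => ?_
    simp only [Kind.argsR, Prm.act_it, Prm.act_vs]
    refine F_append π π 1 (fun w => by simp) (fun b => ?_) a
    simp only [Perm.coe_one, id_eq]; split_ifs <;> simp
  case sel =>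
    refine perm_of_comp_eq (n := n + 2) (blockPerm π 1) fun a => ?_
    simp only [Kind.argsR, Prm.act_it, Prm.act_vs]
    refine F_append π π 1 (fun w => ?_) (fun b => ?_) a
    · by_cases h : w ≠ P.vs 0 ∧ w ∈ L.1.X ∧ L.1.lam (P.vs 0) ≤ L.1.lam w
      · have h' : π w ≠ π (P.vs 0) ∧ π w ∈ (L.act π).1.X ∧ (L.act π).1.lam (π (P.vs 0)) ≤ (L.act π).1.lam (π w) := by
          simpa [π.injective.eq_iff] using h
        rw [if_pos h, if_pos h']; simp
      · have h' : ¬ (π w ≠ π (P.vs 0) ∧ π w ∈ (L.act π).1.X ∧ (L.act π).1.lam (π (P.vs 0)) ≤ (L.act π).1.lam (π w)) := by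
          simpa [π.injective.eq_iff] using h
        rw [if_neg h, if_neg h']; simp
    · simp only [Perm.coe_one, id_eq]
      by_cases hv : P.vs 0 ∈ L.1.X <;> by_cases h0 : (b : ℕ) = 0 <;> simp [hv, h0]
  case hasSel => exact perm_of_comp_eq (n := n) π fun a => by simp [Kind.argsR]
  case pok =>
    refine perm_of_comp_eq (n := n * n) (pp π π) fun a => ?_
    simp only [Kind.argsR, Prm.act_it]
    by_cases h1 : a.divNat ∈ L.1.U <;> by_cases h2 : a.modNat ∈ L.1.U <;> simp [h1, h2]
  case nWs =>
    refine perm_of_comp_eq (n := n) π fun u => ?_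
    simp only [Kind.argsR, Prm.act_it, Prm.act_vs]
    by_cases h : u ∈ L.1.U <;> simp [h]
  case fLT =>
    simp only [Kind.argsR, Prm.act_it, Prm.act_vs, Prm.act_rd]
    rcases hrd : P.rd with ⟨_ | t, ht⟩
    · exact perm_of_eq (n := 1) fun a => by simp [F_iLTW]
    · exact perm_of_eq (n := 1) fun a => by simp
  case fcge =>
    refine perm_of_comp_eq (n := n + n) (blockPerm π π) fun a => ?_
    simp only [Kind.argsR, Prm.act_it, Prm.act_vs, Prm.act_rd]
    exact F_append π π π (fun w' => by simp) (fun w' => by simp) a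
  case fallb => exact perm_of_comp_eq (n := n) π fun a => by simp [Kind.argsR]
  case flex => exact perm_of_comp_eq (n := n) π fun a => by simp [Kind.argsR]
  all_goals exact perm_of_eq fun a => by simp [Kind.argsR]

set_option maxHeartbeats 4000000 in
/-- Main atoms. -/
theorem Kind.argsM_perm (k : Kind) (P : Prm r n) :
    (List.ofFn (Kind.argsM (K := K) (r := r) (L.act π) k (P.act π))).Perm ((List.ofFn (Kind.argsM L k P)).map (F π)) := by
  cases k
  case rkGE =>
    refine perm_of_comp_eq (n := n + n) (blockPerm π 1) fun a => ?_
    simp only [Kind.argsM, Prm.act_s, Prm.act_vs]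
    exact F_cnt π π (fun w' => by simp) a
  case mtch =>
    refine perm_of_comp_eq (n := n + n + n * n) (blockPerm (blockPerm π π) (pp π π)) fun a => ?_
    simp only [Kind.argsM, chLab_act, Prm.act_it]
    rcases hc : chLab L P with _ | Lc <;>
      exact F_append π _ _ (F_append π _ _ (fun v => by simp) (fun v => by simp)) (fun i => by simp) a
  case thru =>
    refine perm_of_eq (n := T n) fun it => ?_
    simp only [Kind.argsM, chLab_act, Prm.act_vs, Prm.act_fl]
    rcases hc : chLab L P with _ | Lc
    · simp
    · cases P
      rename_i it' rd s vs ns h1 h2 o1 o2 us fl b bp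
      cases fl <;> simp
  case cert =>
    refine perm_of_eq (n := 4) fun a => ?_
    simp only [Kind.argsM, chLab_act, Prm.act_vs]
    rcases hc : chLab L P with _ | Lc
    · simp
    · simp only [Option.map_some]
      split_ifs <;> simp
  case pcand =>
    refine perm_of_eq (n := n) fun j => ?_
    simp only [Kind.argsM, Prm.act_vs, Prm.act_h1, Prm.act_ns, candLab_act]
    rcases hc : candLab L (P.vs 0) P.h1 with _ | Lc <;> simp
  case lcrk => exact perm_of_comp_eq (n := n) π fun w => by simp [Kind.argsM]
  case pfx =>
    refine perm_of_eq (n := NB r n) fun i => ?_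
    simp only [Kind.argsM, Prm.act_vs, Prm.act_h1, Prm.act_h2, Prm.act_b]
    split_ifs <;> simp
  case lexLE =>
    refine perm_of_eq (n := NB r n + 1) fun i => ?_
    simp only [Kind.argsM, Prm.act_vs, Prm.act_h1, Prm.act_h2]
    by_cases h : (i : ℕ) < NB r n <;> simp [h]
  case best =>
    refine perm_of_comp_eq (n := n * (n + 1) + 1) (blockPerm (pp π 1) 1) fun a => ?_
    simp only [Kind.argsM, Prm.act_vs, Prm.act_h1]
    exact F_append π _ _ (fun i => by simp [chAct]) (fun i => by simp [chAct]) a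
  case ivbit =>
    refine perm_of_comp_eq (n := n * (n + 1)) (pp π 1) fun i => ?_
    simp only [Kind.argsM, Prm.act_b]
    by_cases h : (P.b : ℕ) < NB r n <;> simp [h]
  case inonbot => exact perm_of_comp_eq (n := n * (n + 1)) (pp π 1) fun i => by simp [Kind.argsM, chAct]
  case isP =>
    refine perm_of_comp_eq (n := n) π fun v => ?_
    simp only [Kind.argsM, Prm.act_vs, Prm.act_us]
    by_cases h : P.vs 0 ∈ L.1.U ∧ P.us ⊂ L.1.U ∧ P.us.Nonempty
    · have h' : π (P.vs 0) ∈ (L.act π).1.U ∧ P.us.map π.toEmbedding ⊂ (L.act π).1.U ∧ (P.us.map π.toEmbedding).Nonempty := by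
        simpa [Finset.map_ssubset_map] using h
      rw [if_pos h, if_pos h']
      by_cases hv : v ∈ P.us <;> simp [hv]
    · have h' : ¬ (π (P.vs 0) ∈ (L.act π).1.U ∧ P.us.map π.toEmbedding ⊂ (L.act π).1.U ∧ (P.us.map π.toEmbedding).Nonempty) := by
        simpa [Finset.map_ssubset_map] using h
      rw [if_neg h, if_neg h']
      simp
  case pcov => exact perm_of_comp_eq (n := 2 ^ n) (fsP π) fun e => by simp [Kind.argsM, chAct]
  case pnonbot =>
    refine perm_of_comp_eq (n := n) π fun u => ?_
    simp only [Kind.argsM]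
    by_cases h : u ∈ L.1.U <;> simp [h]
  case pbit =>
    refine perm_of_comp_eq (n := 2 ^ n) (fsP π) fun e => ?_
    simp only [Kind.argsM, Prm.act_vs]
    by_cases h : (P.bp : ℕ) < NBp r n
    · simp only [Prm.act_bp, dif_pos h]
      rcases hs : bpdec (⟨P.bp, h⟩ : Fin (NBp r n)) with s | b
      · by_cases hc : (fsEnum n e).card = (s : ℕ) <;> simp [hc]
      · rw [fsEnum_fsP, partLab_act]
        rcases hp : partLab L (fsEnum n e) with _ | Lc <;> simp
    · simp only [Prm.act_bp, dif_neg h]; simp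
  case rkInGE =>
    refine perm_of_comp_eq (n := n + n) (blockPerm π 1) fun a => ?_
    simp only [Kind.argsM, Prm.act_s, Prm.act_vs, Prm.act_us]
    refine F_cnt π π (fun w' => ?_) a
    by_cases h : w' ∈ P.us <;> simp [h]
  case pcP =>
    refine perm_of_comp_eq (n := n * n) (pp π 1) fun i => ?_
    simp only [Kind.argsM, Prm.act_vs, Prm.act_us, Prm.act_ns, partLab_act]
    rcases hp : partLab L P.us with _ | Lc
    · simp
    · simp only [Option.map_some]
      by_cases h : i.divNat ∈ P.us <;> simp [h]
  case ppc => exact perm_of_comp_eq (n := 2 ^ n) (fsP π) fun e => by simp [Kind.argsM]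
  case pcrk => exact perm_of_comp_eq (n := n) π fun w => by simp [Kind.argsM]
  case ppfx =>
    refine perm_of_eq (n := NBp r n) fun i => ?_
    simp only [Kind.argsM, Prm.act_vs, Prm.act_bp]
    split_ifs <;> simp
  case plexLT => exact perm_of_eq (n := NBp r n) fun i => by simp [Kind.argsM]
  case pstGE =>
    refine perm_of_comp_eq (n := n + n) (blockPerm π 1) fun a => ?_
    simp only [Kind.argsM, Prm.act_s, Prm.act_vs]
    exact F_cnt π π (fun w => by simp) a
  case pbcGE =>
    refine perm_of_comp_eq (n := n + n) (blockPerm π 1) fun a => ?_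
    simp only [Kind.argsM, Prm.act_s, Prm.act_vs]
    exact F_cnt π π (fun w => by simp [aPlexEQ]) a
  case pat =>
    refine perm_of_eq (n := n + 1) fun sv => ?_
    simp only [Kind.argsM, Prm.act_vs, Prm.act_ns]
    by_cases h : ((P.ns 2 : Fin n) : ℕ) < sv ∧ (P.ns 1 : ℕ) * sv + (P.ns 2 : ℕ) ≤ (P.ns 0 : ℕ) ∧ ((P.ns 1 : ℕ) + 1) * sv ≤ n
    · rw [dif_pos h, dif_pos h]; simp
    · rw [dif_neg h, dif_neg h]; simp
  case off => exact perm_of_eq (n := n) fun i => by simp [Kind.argsM]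
  case blkI => exact perm_of_eq (n := n) fun o => by simp [Kind.argsM]
  case samePart => exact perm_of_comp_eq (n := n * n) (pp π 1) fun k => by simp [Kind.argsM]
  case spc => exact perm_of_comp_eq (n := n * n) (pp π 1) fun k => by simp [Kind.argsM]
  case svadj =>
    refine perm_of_comp_eq (n := n * n * n + n * n) (blockPerm (pp (pp π 1) 1) (pp π π)) fun a => ?_
    simp only [Kind.argsM, Prm.act_vs, Prm.act_ns]
    exact F_append π _ _ (fun k => by simp) (fun k => by simp) a
  case svext =>
    refine perm_of_comp_eq (n := n * n) (pp π 1) fun k => ?_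
    simp only [Kind.argsM, Prm.act_ns, Prm.act_o1]
    rcases ho : P.o1 with _ | o <;> simp
  case svcrk => exact perm_of_comp_eq (n := n) π fun w => by simp [Kind.argsM]
  case vbit =>
    refine perm_of_eq (n := 1) fun a => ?_
    simp only [Kind.argsM, Prm.act_vs, Prm.act_b, Lab.act_val, RawLab.card_act_U]
    by_cases h : (P.b : ℕ) < NB r n
    · simp only [dif_pos h]
      by_cases h1 : L.1.U.card ≤ 1
      · rw [if_pos h1, if_pos h1, F_leafBitW]
      · rw [if_neg h1, if_neg h1]
        rcases hb : bdec (⟨P.b, h⟩ : Fin (NB r n)) with ⟨p, q⟩ | ⟨p, o⟩ | ⟨p, j⟩ <;> dsimp only <;> split_ifs <;> simp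
    · simp only [dif_neg h]; simp
  all_goals exact perm_of_eq fun a => by simp [Kind.argsM]

/-- **Every atom's argument tuple is relabelled up to a permutation of positions.** -/
theorem Atom.args_perm (a : Atom K r n) :
    (List.ofFn (Atom.args (a.act π))).Perm ((List.ofFn (Atom.args a)).map (F π)) := by
  cases a with
  | tt => exact perm_of_eq (n := 0) fun a => a.elim0
  | ff => exact perm_of_eq (n := 0) fun a => a.elim0
  | oo o o' => exact perm_of_eq (n := 2) fun a => by simp only [Atom.args, Atom.act_oo]; split_ifs <;> simp
  | outv b => exact perm_of_comp_eq (n := n) π fun z => by simp [Atom.args]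
  | sh k P => exact SKind.args_perm π k P
  | lab L k P =>
    simp only [Atom.args, Atom.act_lab]
    split_ifs
    · exact Kind.argsR_perm π L k P
    · exact Kind.argsM_perm π L k P

end ArgsPerm

/-! ### The automorphism and symmetry of the compiled circuits -/

section Aut

variable [NeZero n]

/-- **Relabelling the window is an automorphism of the DAG** (for an output wire fixed by the relabelling). -/
theorem isAut (out : Wire K r n) (hout : out.map (dg π) (Node.act π) = out) :
    (wDAG K r n out).IsAut (dg π) (Node.actEquiv π) := by
  refine ⟨hout, fun l => Node.fn_act π l, fun l => ?_⟩
  show (List.ofFn (Node.args (l.act π))).Perm ((List.ofFn (Node.args l)).map (F π))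
  cases l with
  | atom a => exact Atom.args_perm π a
  | natom a => exact perm_of_eq (n := 1) fun _ => rfl
  | f1 f => exact perm_of_eq (n := 8) fun i => (wire_litAct π (f.ls i)).symm
  | f2 f => exact perm_of_eq (n := 4) fun i => rfl

omit [NeZero n] in
/-- The output wires of the entries are fixed. -/
theorem outW_fixed (a b : Fin (r + n)) : (outW K a b).map (dg π) (Node.act π) = outW K a b := by
  have := outW_act (K := K) π a b
  unfold outW at this ⊢
  rcases finSumFinEquiv.symm a with o | p <;> rcases finSumFinEquiv.symm b with o' | q <;> simp only at this ⊢
  · split_ifs <;> rfl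
  all_goals rfl

/-- **The DAG of every entry is symmetric under the budget.** -/
theorem wDAG_isSymm (a b : Fin (r + n)) :
    (wDAG K r n (outW K a b)).IsSymm (GateDAG.diagMaps (pointStabiliserBudget (r + n) n)) := by
  rintro f ⟨ρ, hρ, rfl⟩
  obtain ⟨π, rfl⟩ := exists_extPerm_of_mem_budget hρ
  exact ⟨Node.actEquiv π, isAut π _ (outW_fixed π a b)⟩

/-- **The compiled circuit of every entry is `pointStabiliserBudget (r+n) n`-symmetric.** -/
theorem compile_isSymmetricUnder (a b : Fin (r + n)) :
    (wDAG K r n (outW K a b)).compile.IsSymmetricUnder (pointStabiliserBudget (r + n) n) :=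
  (GateDAG.isSymmetricUnder_compile_iff _ _).2 (wDAG_isSymm a b)

end Aut

end WCan

end Summit.PneNP.PneNP.Theorems

end
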